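import Summits.Ventures.PercRepro.S1TriangleCount
import Summits.Ventures.PercRepro.RankLevelSetTriangleStar

/-!
# PercRepro — THE CONE LEMMA for the triangles through a point under (C1) (p1, gen 20; the case analysis of LEMMA T⁺)

In a finite matroid in which every rank-`2` set has at most `3` elements ((C1)), let `x` be a non-loop with `t`
triangles through it and `U = {x} ∪ ⋃ (triangles through x)`: `|U| = 2t + 1`, `r(U) ≤ t + 1`
(`ThmN.eRk_le_and_ncard_eq_of_triangles`) and `t ≤ ν = |E| − r(E)` (`ThmN.ncard_trianglesThrough_le`).

**THE CONE LEMMA.** If `t = ν` then EVERY triangle of `M` contains `x`. Proof: `t = ν` forces `r(U) = t + 1` and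
`r(E) = r(U) + |E ∖ U|`; so a triangle `T` with `x ∉ T` lies inside `U` (a point `z ∈ T ∖ U` is no coloop, hence
`r(E) = r(E ∖ z) ≤ r(U) + |E ∖ U| − 1`), and then either (a) `T` contains both points `a, b` of a triangle
`{x, a, b}` through `x` — `x ∈ cl {a, b} ⊆ cl T`, so `T ∪ {x}` is a `4`-point set of rank `2`, against (C1) — or
(b) `T` meets every triangle through `x` in at most one point; the triangles through `x` meeting `T` number `≥ 3`
and lie in `cl ({x} ∪ T)`, of rank `≤ 3`, and every further triangle through `x` raises the rank by at most one
(`eRk_union_le_of_mem_trianglesThrough`, submodularity), so `r(U) ≤ 3 + (t − 3) = t`: contradiction.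

* `eRk_union_le_of_mem_trianglesThrough` — `r(V ∪ C) ≤ r(V) + 1` for a triangle `C` through `x ∈ V`;
* `eRk_union_biUnion_le` — `r(V ∪ ⋃ s) ≤ r(V) + |s|` for a finite set `s` of triangles through `x ∈ V`;
* **`mem_of_mem_triangles_of_ncard_trianglesThrough_eq`** — the cone lemma.
Used by `S1TrianglePlus` (LEMMA T⁺: `2·s₃ + ν ≤ ν² + 2`). Axioms: standard.
-/

open scoped Matroid

namespace PercRepro

namespace S1

open Set

variable {α : Type}

/-- Adding a triangle `C` through `x` to a set `V ∋ x` raises the rank by at most one: submodularity with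
`r(V ∩ C) ≥ r {x} = 1` and `r(C) = 2`. -/
theorem eRk_union_le_of_mem_trianglesThrough (M : Matroid α) [M.Finite] {x : α} (hx : M.IsNonloop x)
    {C V : Set α} (hC : C ∈ ThmN.trianglesThrough M x) (hxV : x ∈ V) :
    M.eRk (V ∪ C) ≤ M.eRk V + 1 := by
  have hsub := M.eRk_inter_add_eRk_union_le V C
  rw [ThmN.eRk_eq_two_of_mem_trianglesThrough M hC] at hsub
  have h1 : (1 : ℕ∞) ≤ M.eRk (V ∩ C) := by
    rw [← hx.eRk_eq]
    exact M.eRk_mono (singleton_subset_iff.2 ⟨hxV, hC.2.2⟩)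
  have h2 : (1 : ℕ∞) + M.eRk (V ∪ C) ≤ 1 + (M.eRk V + 1) := by
    calc (1 : ℕ∞) + M.eRk (V ∪ C) ≤ M.eRk (V ∩ C) + M.eRk (V ∪ C) := by gcongr
      _ ≤ M.eRk V + 2 := hsub
      _ = 1 + (M.eRk V + 1) := by ring
  exact (WithTop.add_le_add_iff_left WithTop.one_ne_top).1 h2

/-- `r(V ∪ ⋃ s) ≤ r(V) + |s|` for a finite set `s` of triangles through `x ∈ V`. -/
theorem eRk_union_biUnion_le (M : Matroid α) [M.Finite] {x : α} (hx : M.IsNonloop x)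
    {V : Set α} (hxV : x ∈ V) (s : Finset (Set α)) (hs : ∀ C ∈ s, C ∈ ThmN.trianglesThrough M x) :
    M.eRk (V ∪ ⋃ C ∈ s, C) ≤ M.eRk V + s.card := by
  classical
  induction s using Finset.induction_on with
  | empty => simp
  | insert C₀ s hC₀s ih =>
    have hs' : ∀ C ∈ s, C ∈ ThmN.trianglesThrough M x :=
      fun C hC => hs C (Finset.mem_insert_of_mem hC)
    have hC₀ : C₀ ∈ ThmN.trianglesThrough M x := hs C₀ (Finset.mem_insert_self C₀ s)
    rw [Finset.set_biUnion_insert, Finset.card_insert_of_notMem hC₀s]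
    have heq : V ∪ (C₀ ∪ ⋃ C ∈ s, C) = (V ∪ ⋃ C ∈ s, C) ∪ C₀ := by
      rw [Set.union_left_comm, Set.union_comm C₀]
    rw [heq]
    calc M.eRk ((V ∪ ⋃ C ∈ s, C) ∪ C₀) ≤ M.eRk (V ∪ ⋃ C ∈ s, C) + 1 :=
          eRk_union_le_of_mem_trianglesThrough M hx hC₀ (Set.mem_union_left _ hxV)
      _ ≤ M.eRk V + s.card + 1 := by gcongr; exact ih hs'
      _ = M.eRk V + ((s.card + 1 : ℕ) : ℕ∞) := by push_cast; ring

/-- **THE CONE LEMMA.** Under (C1), if the nullity `d` (`|E| = r(E) + d`) equals the number of triangles through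
the non-loop `x`, then every triangle of `M` contains `x`. -/
theorem mem_of_mem_triangles_of_ncard_trianglesThrough_eq (M : Matroid α) [M.Finite]
    (hC1 : ∀ L ⊆ M.E, M.eRk L = 2 → L.ncard ≤ 3) {x : α} (hx : M.IsNonloop x) {d : ℕ}
    (hd : M.E.encard = M.eRank + d) (ht : (ThmN.trianglesThrough M x).ncard = d)
    {T : Set α} (hT : T ∈ ThmN.triangles M) : x ∈ T := by
  classical
  by_contra hxT
  have hTE : T ⊆ M.E := hT.1.subset_ground
  have hTfin : T.Finite := M.ground_finite.subset hTE
  have hT3 : T.ncard = 3 := hT.2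
  -- the triangles through `x` as a finset
  have hSfin : (ThmN.trianglesThrough M x).Finite :=
    M.ground_finite.finite_subsets.subset (fun C hC => hC.1.subset_ground)
  set s := hSfin.toFinset with hsdef
  have hs : ∀ C ∈ s, C ∈ ThmN.trianglesThrough M x :=
    fun C hC => (Set.Finite.mem_toFinset hSfin).1 hC
  have hmem : ∀ C, C ∈ s ↔ C ∈ ThmN.trianglesThrough M x :=
    fun C => Set.Finite.mem_toFinset hSfin
  have hscard : s.card = d := by
    rw [hsdef, ← Set.ncard_eq_toFinset_card _ hSfin, ht]
  obtain ⟨hr, hc⟩ := ThmN.eRk_le_and_ncard_eq_of_triangles M hC1 hx s hs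
  set U : Set α := {x} ∪ ⋃ C ∈ s, C with hU
  have hUE : U ⊆ M.E := by
    intro z hz
    rcases hz with hz | hz
    · rw [Set.mem_singleton_iff.1 hz]; exact hx.mem_ground
    · obtain ⟨C, hC, hzC⟩ := Set.mem_iUnion₂.1 hz
      exact (hs C hC).1.subset_ground hzC
  have hUfin : U.Finite := M.ground_finite.subset hUE
  have hxU : x ∈ U := Set.mem_union_left _ (Set.mem_singleton x)
  -- the numbers: `r(E) ≤ r(U) + |E ∖ U|`, `|E| = |U| + |E ∖ U|`, `|U| = 1 + 2d`, `r(U) ≤ 1 + d`, `|E| = r(E) + d`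
  have hrE : M.eRank ≤ M.eRk U + (M.E \ U).encard := by
    have := M.eRk_union_le_eRk_add_encard U (M.E \ U)
    rwa [Set.union_sdiff_cancel hUE, M.eRk_ground] at this
  have hcard : M.E.ncard = U.ncard + (M.E \ U).ncard := by
    conv_lhs => rw [← Set.union_sdiff_cancel hUE]
    exact Set.ncard_union_eq Set.disjoint_sdiff_right hUfin (M.ground_finite.sdiff)
  have hneU : M.eRk U ≠ ⊤ := ((M.eRk_le_encard _).trans_lt hUfin.encard_lt_top).ne
  obtain ⟨a, ha⟩ := ENat.ne_top_iff_exists.1 hneU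
  have hneR : M.eRank ≠ ⊤ :=
    (M.eRank_le_encard_ground.trans_lt M.ground_finite.encard_lt_top).ne
  obtain ⟨r, hr'⟩ := ENat.ne_top_iff_exists.1 hneR
  have e1 : r ≤ a + (M.E \ U).ncard := by
    rw [← ha, ← hr', ← (M.ground_finite.sdiff (t := U)).cast_ncard_eq] at hrE
    exact_mod_cast hrE
  have e2 : a ≤ 1 + s.card := by
    rw [← ha] at hr
    exact_mod_cast hr
  have e3 : M.E.ncard = r + d := by
    rw [← hr', ← M.ground_finite.cast_ncard_eq] at hd
    exact_mod_cast hd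
  -- hence `r(U) = 1 + d` and `r(E) = r(U) + |E ∖ U|`
  have ha' : a = 1 + d := by omega
  have hrexact : r = a + (M.E \ U).ncard := by omega
  -- STEP A: the triangle `T` lies inside `U`
  have hTU : T ⊆ U := by
    by_contra hnot
    obtain ⟨z, hzT, hzU⟩ := Set.not_subset.1 hnot
    have hzE : z ∈ M.E := hTE hzT
    -- `z ∈ cl (E ∖ {z})`: `z` lies on the circuit `T`
    have hzcl : z ∈ M.closure (M.E \ {z}) := by
      have h1 : z ∈ M.closure (T \ {z}) := hT.1.mem_closure_sdiff_singleton_of_mem hzT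
      exact M.closure_subset_closure (Set.sdiff_subset_sdiff_left hTE) h1
    -- so `r(E ∖ {z}) = r(E)`
    have hrEz : M.eRk (M.E \ {z}) = M.eRank := by
      apply le_antisymm
      · rw [← M.eRk_ground]; exact M.eRk_mono Set.sdiff_subset
      · have hsub : M.E ⊆ M.closure (M.E \ {z}) := by
          intro w hw
          by_cases hwz : w = z
          · rw [hwz]; exact hzcl
          · exact M.subset_closure (M.E \ {z}) Set.sdiff_subset ⟨hw, hwz⟩
        calc M.eRank = M.eRk M.E := M.eRank_def
          _ ≤ M.eRk (M.closure (M.E \ {z})) := M.eRk_mono hsub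
          _ = M.eRk (M.E \ {z}) := M.eRk_closure_eq _
    -- but `r(E ∖ {z}) ≤ r(U) + |E ∖ U| − 1`
    have hzEU : z ∈ M.E \ U := ⟨hzE, hzU⟩
    have hsplit : M.E \ {z} = U ∪ ((M.E \ U) \ {z}) := by
      ext w
      simp only [Set.mem_sdiff, Set.mem_singleton_iff, Set.mem_union]
      constructor
      · rintro ⟨hwE, hwz⟩
        by_cases hwU : w ∈ U
        · exact Or.inl hwU
        · exact Or.inr ⟨⟨hwE, hwU⟩, hwz⟩
      · rintro (hwU | ⟨⟨hwE, -⟩, hwz⟩)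
        · exact ⟨hUE hwU, fun h => hzU (h ▸ hwU)⟩
        · exact ⟨hwE, hwz⟩
    have hle : M.eRk (M.E \ {z}) ≤ M.eRk U + ((M.E \ U) \ {z}).encard := by
      rw [hsplit]; exact M.eRk_union_le_eRk_add_encard _ _
    have hcz : ((M.E \ U) \ {z}).ncard + 1 = (M.E \ U).ncard :=
      Set.ncard_sdiff_singleton_add_one hzEU (M.ground_finite.sdiff)
    rw [hrEz, ← hr', ← ha, ← (M.ground_finite.sdiff.sdiff (t := {z})).cast_ncard_eq] at hle
    have e4 : r ≤ a + ((M.E \ U) \ {z}).ncard := by exact_mod_cast hle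
    omega
  -- `T` avoids `x`, so it lies in the union of the triangles through `x`
  have hTs : ∀ w ∈ T, ∃ C ∈ s, w ∈ C := by
    intro w hw
    rcases hTU hw with h | h
    · exact absurd (Set.mem_singleton_iff.1 h ▸ hw) hxT
    · obtain ⟨C, hC, hwC⟩ := Set.mem_iUnion₂.1 h
      exact ⟨C, hC, hwC⟩
  -- STEP B: case (a) — some triangle through `x` has both its other points in `T`
  by_cases hcaseA : ∃ C ∈ s, ∃ a ∈ T, ∃ b ∈ T, a ≠ b ∧ a ∈ C ∧ b ∈ C
  · obtain ⟨C, hCs, a, haT, b, hbT, hab, haC, hbC⟩ := hcaseA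
    have hC := hs C hCs
    have hCfin : C.Finite := M.ground_finite.subset hC.1.subset_ground
    have hax : a ≠ x := fun h => hxT (h ▸ haT)
    have hbx : b ≠ x := fun h => hxT (h ▸ hbT)
    -- `C = {x, a, b}`
    have hCeq : C = {x, a, b} := by
      symm
      apply Set.eq_of_subset_of_ncard_le
      · intro w hw
        simp only [Set.mem_insert_iff, Set.mem_singleton_iff] at hw
        rcases hw with rfl | rfl | rfl
        · exact hC.2.2
        · exact haC
        · exact hbC
      · rw [hC.2.1]
        have h3 : ({x, a, b} : Set α).ncard = 3 := by
          rw [Set.ncard_insert_of_notMem, Set.ncard_pair hab]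
          simp only [Set.mem_insert_iff, Set.mem_singleton_iff, not_or]
          exact ⟨Ne.symm hax, Ne.symm hbx⟩
        rw [h3]
      · exact hCfin
    -- `x ∈ cl {a, b} ⊆ cl T`
    have hxcl : x ∈ M.closure T := by
      have h1 : x ∈ M.closure (C \ {x}) := hC.1.mem_closure_sdiff_singleton_of_mem hC.2.2
      have h2 : C \ {x} ⊆ T := by
        intro w hw
        rw [hCeq] at hw
        obtain ⟨hw1, hw2⟩ := hw
        simp only [Set.mem_insert_iff, Set.mem_singleton_iff] at hw1
        rcases hw1 with rfl | rfl | rfl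
        · exact absurd rfl hw2
        · exact haT
        · exact hbT
      exact M.closure_subset_closure h2 h1
    -- so `T ∪ {x}` has rank `2` and `4` points: against (C1)
    have hrT : M.eRk T = 2 := ThmN.eRk_eq_two_of_mem_trianglesThrough M ⟨hT.1, hT.2, haT⟩
    have hrTx : M.eRk (insert x T) = 2 := by
      apply le_antisymm
      · have hsub : insert x T ⊆ M.closure T :=
          Set.insert_subset hxcl (M.subset_closure T hTE)
        calc M.eRk (insert x T) ≤ M.eRk (M.closure T) := M.eRk_mono hsub
          _ = 2 := by rw [M.eRk_closure_eq, hrT]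
      · rw [← hrT]; exact M.eRk_mono (Set.subset_insert x T)
    have hTxE : insert x T ⊆ M.E := Set.insert_subset hx.mem_ground hTE
    have h4 : (insert x T).ncard = 4 := by
      rw [Set.ncard_insert_of_notMem hxT hTfin, hT3]
    have := hC1 (insert x T) hTxE hrTx
    omega
  -- STEP B: case (b) — every triangle through `x` meets `T` in at most one point
  have hcaseB : ∀ C ∈ s, ∀ a ∈ T, ∀ b ∈ T, a ∈ C → b ∈ C → a = b := by
    intro C hC a ha b hb haC hbC
    by_contra hne
    exact hcaseA ⟨C, hC, a, ha, b, hb, hne, haC, hbC⟩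
  -- the triangles through `x` meeting `T`
  set s' : Finset (Set α) := s.filter (fun C => ∃ w ∈ T, w ∈ C) with hs'def
  have hs'sub : s' ⊆ s := Finset.filter_subset _ _
  have hs'mem : ∀ C ∈ s', C ∈ ThmN.trianglesThrough M x := fun C hC => hs C (hs'sub hC)
  -- `|s'| ≥ 3`: the map `T → s'` choosing a triangle through each point is injective
  have hchoice : ∀ w, w ∈ T → ∃ C, C ∈ s' ∧ w ∈ C := by
    intro w hw
    obtain ⟨C, hCs, hwC⟩ := hTs w hw
    exact ⟨C, Finset.mem_filter.2 ⟨hCs, w, hw, hwC⟩, hwC⟩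
  have h3le : 3 ≤ s'.card := by
    let f : α → Set α := fun w => if h : w ∈ T then Classical.choose (hchoice w h) else ∅
    have hf : ∀ w ∈ T, f w ∈ (↑s' : Set (Set α)) := by
      intro w hw
      simp only [f, dif_pos hw]
      exact Finset.mem_coe.2 (Classical.choose_spec (hchoice w hw)).1
    have hfw : ∀ w (hw : w ∈ T), w ∈ f w := by
      intro w hw
      simp only [f, dif_pos hw]
      exact (Classical.choose_spec (hchoice w hw)).2
    have hinj : Set.InjOn f T := by
      intro u hu v hv huv
      have hu' : u ∈ f u := hfw u hu
      have hv' : v ∈ f u := huv ▸ hfw v hv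
      have hfs : f u ∈ s := hs'sub (Finset.mem_coe.1 (hf u hu))
      exact hcaseB (f u) hfs u hu v hv hu' hv'
    have := Set.ncard_le_ncard_of_injOn f hf hinj (Finset.finite_toSet s')
    rw [hT3, Set.ncard_coe_finset] at this
    exact this
  -- the triangles through `x` meeting `T` lie in `cl ({x} ∪ T)`, of rank `≤ 3`
  set V : Set α := insert x T with hV
  have hVE : V ⊆ M.E := Set.insert_subset hx.mem_ground hTE
  have hrV : M.eRk V ≤ 3 := by
    have hrT : M.eRk T = 2 := by
      obtain ⟨w, hw⟩ := hT.1.nonempty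
      exact ThmN.eRk_eq_two_of_mem_trianglesThrough M ⟨hT.1, hT.2, hw⟩
    calc M.eRk V ≤ M.eRk T + 1 := M.eRk_insert_le_add_one x T
      _ = 3 := by rw [hrT]; norm_num
  have hs'cl : ∀ C ∈ s', C ⊆ M.closure V := by
    intro C hC
    obtain ⟨hCs, w, hwT, hwC⟩ := Finset.mem_filter.1 hC
    have hC' := hs C hCs
    have hwx : w ≠ x := fun h => hxT (h ▸ hwT)
    -- `C = {x, w, b}` for its third point `b`, and `b ∈ cl {x, w}`
    have hpair : ({x, w} : Set α) ⊆ V := by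
      intro u hu
      simp only [Set.mem_insert_iff, Set.mem_singleton_iff] at hu
      rcases hu with rfl | rfl
      · exact Set.mem_insert u T
      · exact Set.mem_insert_of_mem x hwT
    have hpairC : ({x, w} : Set α) ⊆ C := by
      intro u hu
      simp only [Set.mem_insert_iff, Set.mem_singleton_iff] at hu
      rcases hu with rfl | rfl
      · exact hC'.2.2
      · exact hwC
    have hCfin : C.Finite := M.ground_finite.subset hC'.1.subset_ground
    have hpair_ssub : ({x, w} : Set α) ⊂ C := by
      refine hpairC.ssubset_of_ne ?_
      intro h
      have := congrArg Set.ncard h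
      rw [Set.ncard_pair (Ne.symm hwx), hC'.2.1] at this
      omega
    have hpair_indep : M.Indep ({x, w} : Set α) := hC'.1.ssubset_indep hpair_ssub
    have hpair_rk : M.eRk ({x, w} : Set α) = 2 := by
      rw [hpair_indep.eRk_eq_encard, Set.encard_pair (Ne.symm hwx)]
    have hCcl : C ⊆ M.closure ({x, w} : Set α) :=
      ThmN.subset_closure_of_eRk_le M hpairC hC'.1.subset_ground hCfin
        (by rw [ThmN.eRk_eq_two_of_mem_trianglesThrough M hC', hpair_rk])
    exact hCcl.trans (M.closure_subset_closure hpair)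
  have hW : M.eRk (V ∪ ⋃ C ∈ s', C) ≤ 3 := by
    have hsub : V ∪ ⋃ C ∈ s', C ⊆ M.closure V := by
      apply Set.union_subset (M.subset_closure V hVE)
      exact Set.iUnion₂_subset hs'cl
    calc M.eRk (V ∪ ⋃ C ∈ s', C) ≤ M.eRk (M.closure V) := M.eRk_mono hsub
      _ = M.eRk V := M.eRk_closure_eq V
      _ ≤ 3 := hrV
  -- every further triangle through `x` raises the rank by at most one: `r(U) ≤ 3 + (d − |s'|) ≤ d`
  have hxVW : x ∈ V ∪ ⋃ C ∈ s', C := Set.mem_union_left _ (Set.mem_insert x T)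
  have hrest : ∀ C ∈ s \ s', C ∈ ThmN.trianglesThrough M x :=
    fun C hC => hs C (Finset.mem_sdiff.1 hC).1
  have hUsub : U ⊆ (V ∪ ⋃ C ∈ s', C) ∪ ⋃ C ∈ s \ s', C := by
    intro z hz
    rcases hz with hz | hz
    · rw [Set.mem_singleton_iff.1 hz]
      exact Set.mem_union_left _ (Set.mem_union_left _ (Set.mem_insert x T))
    · obtain ⟨C, hC, hzC⟩ := Set.mem_iUnion₂.1 hz
      by_cases hC' : C ∈ s'
      · exact Set.mem_union_left _ (Set.mem_union_right _ (Set.mem_iUnion₂.2 ⟨C, hC', hzC⟩))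
      · exact Set.mem_union_right _ (Set.mem_iUnion₂.2 ⟨C, Finset.mem_sdiff.2 ⟨hC, hC'⟩, hzC⟩)
  have hrU' : M.eRk U ≤ 3 + ((s \ s').card : ℕ∞) := by
    calc M.eRk U ≤ M.eRk ((V ∪ ⋃ C ∈ s', C) ∪ ⋃ C ∈ s \ s', C) := M.eRk_mono hUsub
      _ ≤ M.eRk (V ∪ ⋃ C ∈ s', C) + (s \ s').card :=
          eRk_union_biUnion_le M hx hxVW (s \ s') hrest
      _ ≤ 3 + (s \ s').card := by gcongr
  have hsdcard : (s \ s').card + s'.card = s.card := Finset.card_sdiff_add_card_eq_card hs'sub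
  rw [← ha] at hrU'
  have e5 : a ≤ 3 + (s \ s').card := by exact_mod_cast hrU'
  omega

end S1

end PercRepro
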